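import Summits.AtomisticToContinuum.HydrodynamicLimit.Theses.RelayRaceLocality
import Summits.AtomisticToContinuum.HydrodynamicLimit.Theorems.LambertianContactSwapSwapGapEntropyTools
import Literature.Probability.Divergences.EntropyEventBound

/-!
# Crux idea `virgin-front-energy-budget` — first lemmas (crux-ideate r2 k4, stmt-AtomisticToContinuum-12500)

Typed, unproved `Prop`s (they must elaborate; nothing here is an item):

* `ExtensiveTransferAlongFlow` — L1: the relative entropy of the conjunct's gas w.r.t. a HOMOGENEOUS
  Gibbs law is conserved along the deterministic flow (tree: `klDiv_map_flow_localGibbsLaw_const`)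
  and is `≤ h(M)·(N+1)` under the consumer's guards; hence every family of equilibrium events of
  probability `≤ e^{-K(N+1)}`, `K > h`, has probability `→ 0` under the TRUE law at ANY times `s_N`
  (tree: `toReal_measure_le_of_klDiv_le`). Provable now (M-sized).
* `ShellEnergyBound` — L2: the one extensive consequence the front argument consumes: along the true
  law, at any times, the kinetic energy carried inside any fixed region `A` is `≤ Cₑ(M)(1 + |A|)`
  (own-number normalised) with probability `→ 1` (static Chernoff for i.i.d. Maxwellian velocities
  under the homogeneous law + L1). Provable now (M-sized).
* `IslandNoSignallingBuffered` — the RUNG this card's mechanism proves toward: the crux's necessary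
  special case "gas 2 = global equilibrium, same diameter and number" with the consumer's guards
  (`ρ ≤ M`, `M⁻¹ ≤ θ`) and a macroscopic buffer `b₀` (cone `R − b₀ − c t`, `c = c(M, b₀)`).
-/

namespace Summit.AtomisticToContinuum.HydrodynamicLimit.Cruxes.LightConeInLaw.VirginFront

open MeasureTheory Filter Set Topology InformationTheory
open scoped ENNReal
open Literature.MathematicalPhysics.KineticTheory Literature.Analysis.FluidPDE

noncomputable section

/-- Own-number-normalised kinetic energy carried by the particles of `z` whose positions lie in the
region `A ⊆ 𝕋³`: `n⁻¹ Σ_{i : x_i ∈ A} |v_i|²/2`. -/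
def regionKineticEnergy {n : ℕ} (A : Set T3) (z : Config n (Fin 3) T3) : ℝ :=
  (n : ℝ)⁻¹ * ∑ i, A.indicator (fun _ => ‖(z i).2‖ ^ 2 / 2) ((z i).1)

/-- **L1 — extensive transfer along the flow.** For every guard level `M` and homogeneous
reference `(a, 0, θ)` there is an entropy density `h` such that, for all continuous profiles obeying
the consumer's guards, all small `σ`, all flows, every `K > h` and every family of measurable
equilibrium events `A_N` with `G_N(A_N) ≤ e^{-K(N+1)}`, the TRUE law at arbitrary times `s_N`
gives `A_N` probability `→ 0`. (Crude route, `limsup ≤ h/K`: pinned entropy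
`klDiv_map_flow_localGibbsLaw_const` + explicit budget `klDiv_lawAt_le_ofReal_of_profileBounds` + event
bound `toReal_measure_le_of_klDiv_le`. Sharp route, the typed `→ 0`: split at likelihood level `e^{K'(N+1)}`,
`h < K' < K`; the law of `log dP_s/dG = (log dP₀/dG) ∘ Φ_{-s}` under `P_s` is that of the additive STATIC
functional `Σ_i g(z_i) − log(Z₁/Z)` under `P₀` (Liouville), which concentrates at `h(N+1)` by a static
Chernoff bound for local Gibbs laws.) -/
def ExtensiveTransferAlongFlow : Prop :=
  ∀ M : ℝ, 0 < M → ∀ (a θ : ℝ), 0 < a → 0 < θ → ∃ h : ℝ, 0 ≤ h ∧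
  ∀ (a₁ θ₁ : T3 → ℝ) (u₁ : T3 → V3), Continuous a₁ → Continuous θ₁ → Continuous u₁ →
    (∀ x, M⁻¹ ≤ a₁ x ∧ a₁ x ≤ M ∧ M⁻¹ ≤ θ₁ x ∧ θ₁ x ≤ M ∧ ‖u₁ x‖ ≤ M) →
  ∃ σ₀ : ℝ, 0 < σ₀ ∧ ∀ σ : ℝ, 0 < σ → σ < σ₀ →
  ∀ Φ : (N : ℕ) → HardSphereFlow (Torus.geometry (Fin 3)) (hsDiameter σ N) (N + 1),
  ∀ K : ℝ, h < K → ∀ A : (N : ℕ) → Set (Config (N + 1) (Fin 3) T3), (∀ N, MeasurableSet (A N)) →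
    (∀ N, localGibbsLaw σ (fun _ => a) (fun _ => 0) (fun _ => θ) N (Φ N) (A N) ≤
        ENNReal.ofReal (Real.exp (-(K * ((N : ℝ) + 1))))) →
    ∀ s : ℕ → ℝ,
      Tendsto (fun N => ((Φ N).lawAt (localGibbsLaw σ a₁ u₁ θ₁ N (Φ N)) (s N)) (A N)) atTop (𝓝 0)

/-- **L2 — shell energy bound (extensive energy localisation along the true law).** For every guard
level `M` there is `Cₑ` such that, for guarded profiles, small `σ`, all flows, every measurable region
`A ⊆ 𝕋³` and arbitrary times `s_N`, the own-number-normalised kinetic energy inside `A` at time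
`s_N` exceeds `Cₑ (1 + |A|)` only with probability `→ 0`. The `1` is the global free-energy budget
`h(M)`: energy MAY concentrate (entropy cannot forbid it) but only up to an `N`-independent total. -/
def ShellEnergyBound : Prop :=
  ∀ M : ℝ, 0 < M → ∃ Cₑ : ℝ, 0 < Cₑ ∧
  ∀ (a₁ θ₁ : T3 → ℝ) (u₁ : T3 → V3), Continuous a₁ → Continuous θ₁ → Continuous u₁ →
    (∀ x, M⁻¹ ≤ a₁ x ∧ a₁ x ≤ M ∧ M⁻¹ ≤ θ₁ x ∧ θ₁ x ≤ M ∧ ‖u₁ x‖ ≤ M) →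
  ∃ σ₀ : ℝ, 0 < σ₀ ∧ ∀ σ : ℝ, 0 < σ → σ < σ₀ →
  ∀ Φ : (N : ℕ) → HardSphereFlow (Torus.geometry (Fin 3)) (hsDiameter σ N) (N + 1),
  ∀ A : Set T3, MeasurableSet A → ∀ s : ℕ → ℝ,
    Tendsto (fun N => ((Φ N).lawAt (localGibbsLaw σ a₁ u₁ θ₁ N (Φ N)) (s N))
      {z | Cₑ * (1 + (volume A).toReal) < regionKineticEnergy A z}) atTop (𝓝 0)

/-- **Target rung — buffered equilibrium-island no-signalling with the consumer's guards.**
Necessary special case of `RelayRaceLocality.LightConeInLaw` (gas 2 := the homogeneous gas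
`(a, 0, θ)` with the SAME diameter and `N+1` spheres, so `P₂ = localGibbsLaw σ a 0 θ`; extra guards
`ρ ≤ M`, `M⁻¹ ≤ Θ`; test functions supported in `B(x₀, R − b₀ − c t)` with `c = c(M, b₀)`): a gas in
local equilibrium that coincides with a global equilibrium state on a ball cannot signal into the
buffered shrinking ball. The homogeneous gas's tie/probability hypotheses are omitted (tree
theorems: invariance + static LLN). -/
def IslandNoSignallingBuffered : Prop :=
  ∃ η₀ : ℝ, 0 < η₀ ∧ ∀ M : ℝ, 0 < M → ∀ b₀ : ℝ, 0 < b₀ → ∃ c : ℝ, 0 < c ∧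
  ∀ (a₁ θ₁ : T3 → ℝ) (u₁ : T3 → V3), Continuous a₁ → Continuous θ₁ → Continuous u₁ →
    (∀ x, 0 < a₁ x) → (∀ x, 0 < θ₁ x) → ∀ (a θ : ℝ), 0 < a → M⁻¹ ≤ θ → θ ≤ M →
  ∃ σ₀ : ℝ, 0 < σ₀ ∧ ∀ σ : ℝ, 0 < σ → σ < σ₀ →
  ∀ (T : ℝ) (ρ Θ : ℝ → T3 → ℝ) (U : ℝ → T3 → V3), IsHardSphereEulerSolution σ T ρ U Θ →
  ∀ Φ : (N : ℕ) → HardSphereFlow (Torus.geometry (Fin 3)) (hsDiameter σ N) (N + 1),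
  let P₁ : (N : ℕ) → Measure (Config (N + 1) (Fin 3) T3) := fun N => localGibbsLaw σ a₁ u₁ θ₁ N (Φ N)
  let G : (N : ℕ) → Measure (Config (N + 1) (Fin 3) T3) :=
    fun N => localGibbsLaw σ (fun _ => a) (fun _ => 0) (fun _ => θ) N (Φ N)
  TendstoHydroFieldsAt P₁ Φ ρ U Θ 0 →
  ∀ t : ℝ, 0 ≤ t → t < T →
    (∀ s ∈ Set.Icc 0 t, ∀ x, ρ s x * σ ^ 3 < η₀ ∧ ρ s x ≤ M ∧ Θ s x ≤ M ∧ M⁻¹ ≤ Θ s x ∧ ‖U s x‖ ≤ M) →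
  ∀ (x₀ : T3) (R : ℝ), (∀ x, Torus.euclidDist x x₀ < R → ρ 0 x = 1 ∧ U 0 x = 0 ∧ Θ 0 x = θ) →
  ∀ χ : T3 → ℝ, Continuous χ → (∀ x, R - b₀ - c * t ≤ Torus.euclidDist x x₀ → χ x = 0) →
  ∀ F : ℝ × V3 × ℝ → ℝ, LipschitzWith 1 F → (∀ p, |F p| ≤ 1) →
    Tendsto (fun N =>
      (∫ z, F (σ ^ 3 * empiricalDensityField ((Φ N).flow t z) χ,
          (σ ^ 3) • empiricalMomentumField ((Φ N).flow t z) χ,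
          σ ^ 3 * empiricalEnergyField ((Φ N).flow t z) χ) ∂(P₁ N)) -
        ∫ z, F (σ ^ 3 * empiricalDensityField ((Φ N).flow t z) χ,
          (σ ^ 3) • empiricalMomentumField ((Φ N).flow t z) χ,
          σ ^ 3 * empiricalEnergyField ((Φ N).flow t z) χ) ∂(G N)) atTop (𝓝 0)

/-- Sanity: the pinned-entropy tool this card leans on is the tree theorem (pointer by name). -/
example := @Summit.AtomisticToContinuum.HydrodynamicLimit.Theorems.klDiv_map_flow_localGibbsLaw_const

/-- Sanity: the event-transfer tool (Kipnis–Landim App. 1 Prop. 8.2) is the tree theorem. -/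
example := @Literature.Probability.Divergences.toReal_measure_le_of_klDiv_le

end

end Summit.AtomisticToContinuum.HydrodynamicLimit.Cruxes.LightConeInLaw.VirginFront
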